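import Mathlib.RingTheory.WittVector.Complete
import Mathlib.RingTheory.WittVector.DiscreteValuationRing
import Mathlib.FieldTheory.IsAlgClosed.Basic
import Mathlib.RingTheory.LocalRing.ResidueField.Defs
import Literature.AlgebraicGeometry.Motives.CrystallineRealization
import HarnessLib

/-!
# Crux `EquisingularLift` (stmt-ResolutionOfSingularities-15660), line `strata-split`:
# stub `stub_wittRing`

The characteristic-`0` lift of an algebraically closed field `k` of characteristic `p`: the ring of
Witt vectors `O = 𝕎(k)` (Mathlib `WittVector p k`) is a complete discrete valuation ring of
characteristic `0` with maximal ideal `(p)`, residue field `𝕎(k)/(p) ≅ k` (hence algebraically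
closed), and the constant-coefficient map `𝕎(k) → k` is a surjective ring homomorphism
(Serre, *Local Fields*, II §5–§6).

Everything is assembled from Mathlib (`WittVector.isDiscreteValuationRing`,
`WittVector.isAdicCompleteIdealSpanP`, `WittVector.ker_constantCoeff`, `WittVector.quotientPEquiv`,
`WittVector.constantCoeff_surjective`, `IsAlgClosed.perfectField`, `IsAlgClosed.of_ringEquiv`) and
the tree instance
`Literature.AlgebraicGeometry.Motives.charZero_wittVector` (`CharZero (𝕎 k)`).
-/

set_option linter.dupNamespace false -- mandated namespace of this single-conjunct summit

namespace Summit.ResolutionOfSingularities.ResolutionOfSingularities.Cruxes.EquisingularLift.StrataSplit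

/-- The maximal ideal of the Witt ring `𝕎(k)` of a perfect field `k` of characteristic `p` is the
ideal `(p)`: it is the kernel of the surjection `constantCoeff : 𝕎(k) → k` onto a field
(Mathlib `WittVector.ker_constantCoeff`), and in a local ring a maximal ideal is THE maximal ideal.
[cite: Serre1979, II §6] -/
theorem maximalIdeal_wittVector_eq_span_p (p : ℕ) [Fact p.Prime] (k : Type) [Field k] [CharP k p]
    [PerfectRing k p] :
    IsLocalRing.maximalIdeal (WittVector p k) = Ideal.span {(p : WittVector p k)} := by
  rw [← WittVector.ker_constantCoeff (p := p) (k := k)]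
  exact (IsLocalRing.eq_maximalIdeal (RingHom.ker_isMaximal_of_surjective
    (WittVector.constantCoeff : WittVector p k →+* k) (WittVector.constantCoeff_surjective p))).symm

/-- The residue field of the Witt ring `𝕎(k)` of an algebraically closed field `k` of
characteristic `p` is algebraically closed: `𝕎(k)/𝔪 = 𝕎(k)/(p) ≅ k` via the constant coefficient
(Mathlib `WittVector.quotientPEquiv`), and algebraic closedness transports along ring isomorphisms.
[cite: Serre1979, II §6] -/
theorem isAlgClosed_residueField_wittVector (p : ℕ) [Fact p.Prime] (k : Type) [Field k]
    [CharP k p] [IsAlgClosed k] : IsAlgClosed (IsLocalRing.ResidueField (WittVector p k)) :=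
  IsAlgClosed.of_ringEquiv k _
    ((Ideal.quotEquivOfEq (maximalIdeal_wittVector_eq_span_p p k)).trans
      WittVector.quotientPEquiv).symm

/-- **STUB `stub_wittRing` (known; Witt vectors).** For a prime `p` and an algebraically closed
field `k` of characteristic `p` there is a complete discrete valuation ring `O` of characteristic
`0` with algebraically closed residue field together with a surjective ring homomorphism `O → k`:
`O = 𝕎(k)` the Witt vectors (a DVR since `k` is perfect, `p`-adically complete, `𝔪 = (p)`,
`𝕎(k)/(p) ≅ k`), `π = constantCoeff` (the `0`-th Witt component, split by the Teichmüller lift).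
Registered stub `stub_wittRing` of the line `strata-split` of crux
stmt-ResolutionOfSingularities-15660. [cite: Serre1979, II §5–§6] -/
theorem stub_wittRing : ∀ p : ℕ, p.Prime → ∀ (k : Type) [Field k] [CharP k p] [IsAlgClosed k],
    ∃ (O : Type) (_ : CommRing O) (_ : IsDomain O) (_ : IsDiscreteValuationRing O) (_ : CharZero O)
      (_ : IsAdicComplete (IsLocalRing.maximalIdeal O) O) (_ : IsAlgClosed (IsLocalRing.ResidueField O))
      (π : O →+* k), Function.Surjective π := by
  intro p hp k _ _ _
  haveI : Fact p.Prime := ⟨hp⟩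
  have hcomplete : IsAdicComplete (IsLocalRing.maximalIdeal (WittVector p k)) (WittVector p k) := by
    rw [maximalIdeal_wittVector_eq_span_p p k]
    exact WittVector.isAdicCompleteIdealSpanP
  exact ⟨WittVector p k, inferInstance, inferInstance, inferInstance, inferInstance, hcomplete,
    isAlgClosed_residueField_wittVector p k, WittVector.constantCoeff,
    WittVector.constantCoeff_surjective (R := k) p⟩

end Summit.ResolutionOfSingularities.ResolutionOfSingularities.Cruxes.EquisingularLift.StrataSplit
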